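import Mathlib

/-!
# T5HoweDichotomy — the kernel-checkable core of route/T5-SUPPORT-p3.md §14
(cell pub-hodge-repro2, Tier 5, sub-step N3 row T2 / residual [G-N3-1]; seat p3)

§14 of the support memo derives, from Mœglin–Vignéras–Waldspurger (LNM 1291, Ch. 3 §IV.4,
«Théorème principal», parts 1) a), 1) b), 1) c), 2) b)), the uniqueness of the `U(W_v)`-partner of
`σ_v` at every non-split place where `(π₀,v)^∨` is cuspidal.  Three things in that derivation are
elementary enough to be checked by the kernel, and this file does exactly those three and nothing more:

1. `exists_graded_piece_surjects` / `exists_factor_through_graded_piece` — the module-theoretic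
   content of MVW's «2)b) se déduit facilement de (5)»: a simple quotient of a module carrying a
   finite decreasing filtration `F 0 = ⊤ ⊇ F 1 ⊇ … ⊇ F (k+1) = ⊥` is a quotient of ONE graded
   piece `F i / F (i+1)` (the piece `τ_0` gives branch (i) of the printed dichotomy, the pieces
   `τ_i`, `i ≥ 1`, branch (ii)).
2. `exponent_displays_eq_iff`, `exponent_instance_*` — the bookkeeping of the reading note
   [R-MVW-exp] (§14(f)): the two printed exponent displays `(n' - n + t + η)/2` (Corollaire 6 a))
   and `(n - n' + t + η')/2` (the display of 2) b) (i)) agree iff `2 (n - n') = η - η'`, so for a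
   unitary pair (`η = η' = 0`) iff `n = n'`; for `(n, n', t) = (3, 2, 1)` they are `0` and `1`.
3. `Data` / `D_sigma_of_cuspidal` / `D_pi_of_cuspidal` — the DEPENDENCY SKELETON of §14(d): the
   printed statements 1) a), 1) c) (as the Case A / Case B alternative) and 2) b) (as the dichotomy
   «every partner pairs with the level-0 component, or every partner is non-cuspidal») are named
   `Prop` fields of a structure; the theorems show that the uniqueness statements (D_σ) and (D_π)
   follow from those fields by propositional reasoning alone.  Nothing here asserts anything about
   representations, Weil representations or MVW's theorem: the fields are hypotheses.

Standard axioms only; no `sorry`.  Blind lane (README §3): Mathlib imports only.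
-/

namespace Summit.Ventures.HodgeRepro2.T5HoweDichotomy

section Filtration

variable {R M Q : Type*} [Ring R] [AddCommGroup M] [Module R M] [AddCommGroup Q] [Module R Q]

/-- A surjective map sends the top filtration step `F 0 = ⊤` onto `Q`. -/
theorem map_zero_eq_top (F : ℕ → Submodule R M) (h0 : F 0 = ⊤) (f : M →ₗ[R] Q)
    (hf : Function.Surjective f) : (F 0).map f = ⊤ := by
  rw [h0, Submodule.map_top, LinearMap.range_eq_top.mpr hf]

/-- The bottom filtration step `F (k+1) = ⊥` does not map onto a non-trivial `Q`. -/
theorem map_ne_top_of_eq_bot [Nontrivial Q] (F : ℕ → Submodule R M) (f : M →ₗ[R] Q) (j : ℕ)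
    (hj : F j = ⊥) : (F j).map f ≠ ⊤ := by
  rw [hj, Submodule.map_bot]
  exact bot_ne_top

/-- **Simple quotients factor through one graded piece.**  Let `F 0 = ⊤ ⊇ F 1 ⊇ … ⊇ F (k+1) = ⊥`
be a finite decreasing filtration of `M` and `f : M → Q` a surjection onto a simple module.  Then
there is an index `i ≤ k` such that `F i` maps onto `Q` while `F (i+1)` maps to `0`: `Q` is a quotient
of the graded piece `F i / F (i+1)`.  (MVW Ch. 3 §IV.10: «2)b) se déduit facilement de (5)» — the
filtration of Théorème 5 with the pieces `τ_i`, `0 ≤ i ≤ inf(t, m')`.) -/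
theorem exists_graded_piece_surjects [IsSimpleModule R Q] (F : ℕ → Submodule R M) (k : ℕ)
    (h0 : F 0 = ⊤) (hk : F (k + 1) = ⊥) (f : M →ₗ[R] Q) (hf : Function.Surjective f) :
    ∃ i ≤ k, (F i).map f = ⊤ ∧ (F (i + 1)).map f = ⊥ := by
  classical
  haveI : Nontrivial Q := IsSimpleModule.nontrivial R Q
  have hex : ∃ j, (F j).map f ≠ ⊤ := ⟨k + 1, map_ne_top_of_eq_bot F f (k + 1) hk⟩
  set j := Nat.find hex with hjdef
  have hjnot : (F j).map f ≠ ⊤ := Nat.find_spec hex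
  have hjle : j ≤ k + 1 := Nat.find_min' hex (map_ne_top_of_eq_bot F f (k + 1) hk)
  have hjpos : j ≠ 0 := by
    intro h
    apply hjnot
    rw [h]
    exact map_zero_eq_top F h0 f hf
  obtain ⟨i, hi⟩ : ∃ i, j = i + 1 := ⟨j - 1, by omega⟩
  refine ⟨i, by omega, ?_, ?_⟩
  · -- `F i` still maps onto `Q`, by minimality of `j = i + 1`
    by_contra hcon
    have := Nat.find_min' hex hcon
    omega
  · -- `F (i+1) = F j` does not map onto `Q`; simplicity leaves only `⊥`
    rw [← hi]
    rcases (eq_bot_or_eq_top ((F j).map f)) with hb | ht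
    · exact hb
    · exact absurd ht hjnot

/-- The same statement in the form «`Q` is a quotient of the graded piece»: a surjective linear map
from the submodule `F i` onto `Q` that vanishes on `F (i+1)`. -/
theorem exists_factor_through_graded_piece [IsSimpleModule R Q] (F : ℕ → Submodule R M) (k : ℕ)
    (h0 : F 0 = ⊤) (hk : F (k + 1) = ⊥) (f : M →ₗ[R] Q) (hf : Function.Surjective f) :
    ∃ i ≤ k, ∃ g : (F i) →ₗ[R] Q, Function.Surjective g ∧
      ∀ x : F i, (x : M) ∈ F (i + 1) → g x = 0 := by
  obtain ⟨i, hik, htop, hbot⟩ := exists_graded_piece_surjects F k h0 hk f hf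
  refine ⟨i, hik, f.comp (F i).subtype, ?_, ?_⟩
  · intro q
    have hq : q ∈ (F i).map f := by rw [htop]; exact Submodule.mem_top
    obtain ⟨x, hx, rfl⟩ := hq
    exact ⟨⟨x, hx⟩, rfl⟩
  · intro x hx
    have : f x ∈ (F (i + 1)).map f := ⟨x, hx, rfl⟩
    rw [hbot] at this
    simpa using this

/-- With only one graded piece (`k = 0`: the filtration is `⊤ ⊇ ⊥`) the simple quotient is a
quotient of `F 0 = M` itself — the case `inf(t, m') = 0` of MVW's Théorème 5, where only `τ_0`
exists and branch (ii) of 2) b) cannot occur (§14(d), the anisotropic `W_v`). -/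
theorem graded_piece_zero_of_single [IsSimpleModule R Q] (F : ℕ → Submodule R M)
    (h0 : F 0 = ⊤) (hk : F 1 = ⊥) (f : M →ₗ[R] Q) (hf : Function.Surjective f) :
    (F 0).map f = ⊤ ∧ (F 1).map f = ⊥ := by
  obtain ⟨i, hi, h⟩ := exists_graded_piece_surjects F 0 h0 hk f hf
  have : i = 0 := by omega
  subst this
  exact h

end Filtration

section Exponents

/-- The two exponent displays of MVW Ch. 3 §IV.4 — `(n' - n + t + η)/2` (Corollaire 6 a), the
`H`-side piece `τ_0`) and `(n - n' + t + η')/2` (the display of 2) b) (i)) — have equal numerators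
iff `2 (n - n') = η - η'`. -/
theorem exponent_displays_eq_iff (n n' t η η' : ℤ) :
    n' - n + t + η = n - n' + t + η' ↔ 2 * (n - n') = η - η' := by
  omega

/-- For a unitary dual pair (`η = η' = 0`) the two displays agree iff `n = n'`. -/
theorem exponent_displays_eq_iff_of_unitary (n n' t : ℤ) :
    n' - n + t + 0 = n - n' + t + 0 ↔ n = n' := by
  omega

/-- The instance of §14(f): `(n, n', t) = (3, 2, 1)`, unitary — the Corollaire 6 a) display gives `0`. -/
theorem exponent_instance_cor6 : ((2 : ℤ) - 3 + 1 + 0) / 2 = 0 := by norm_num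

/-- The instance of §14(f): the display of 2) b) (i) gives `1` for the same data. -/
theorem exponent_instance_2bi : ((3 : ℤ) - 2 + 1 + 0) / 2 = 1 := by norm_num

/-- The display of 1) c) applied to `(π₀,v)^∨` — `n = dim W_v = 2`, `n' = dim V_v = 3`, `t = 1` —
gives the exponent `0` of `r_1(σ_v)`. -/
theorem exponent_instance_1c : ((2 : ℤ) - 3 + 1 + 0) / 2 = 0 := by norm_num

/-- The two instances differ: the printed displays are inconsistent on the example (reading note
[R-MVW-exp]). -/
theorem exponent_instances_ne : ((2 : ℤ) - 3 + 1 + 0) / 2 ≠ ((3 : ℤ) - 2 + 1 + 0) / 2 := by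
  norm_num

/-- The number of graded pieces beyond `τ_0` is `inf(t, m')`; for `m' = 0` (anisotropic `W_v`) it
is `0`. -/
theorem min_t_zero (t : ℕ) : min t 0 = 0 := by simp

end Exponents

section Skeleton

/-- **Dependency skeleton of §14(d).**  `IrrW`, `IrrV`, `IrrV0` stand for the irreducible smooth
representations of `U(W_v)`, `U(V_v)` and `U(V^{an})` (the three Witt levels); `cuspW`, `cuspV`
for cuspidality; `pair1 σ π` for «`σ ⊗ π` is a quotient of `ω_{V_v, W_v}`» and `pair0 χ π` for
«`χ ⊗ π` is a quotient of `ω_{V^{an}, W_v}`»; `jac σ` for the level-0 component `χ₀` of the Jacquet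
module `r_1(σ) = ν^e ⊗ χ₀` (`none` when `σ` is cuspidal).  The five fields are the printed
statements of MVW Ch. 3 §IV.4 as §14(d) reads them; they are HYPOTHESES of this structure, not
theorems of this file. -/
structure Data (IrrW IrrV IrrV0 : Type*) where
  /-- cuspidality on `U(W_v)` -/
  cuspW : IrrW → Prop
  /-- cuspidality on `U(V_v)` -/
  cuspV : IrrV → Prop
  /-- `σ ⊗ π` is a quotient of `ω_{V_v, W_v}` -/
  pair1 : IrrV → IrrW → Prop
  /-- `χ ⊗ π` is a quotient of `ω_{V^{an}, W_v}` -/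
  pair0 : IrrV0 → IrrW → Prop
  /-- the level-0 component of `r_1(σ)`, when `r_1(σ) = ν^e ⊗ χ₀` is irreducible (`none`: cuspidal) -/
  jac : IrrV → Option IrrV0
  /-- 1) a) for a cuspidal `π ∈ Irr(U(W_v))`: its partner at `V_v` is unique (the big theta
  `ϑ_1(π)` is irreducible, every partner is a quotient of it). -/
  uniqV_of_cuspW : ∀ π, cuspW π → ∀ σ σ', pair1 σ π → pair1 σ' π → σ = σ'
  /-- 1) a) for a cuspidal `σ ∈ Irr(U(V_v))` (roles exchanged): its partner at `W_v` is unique. -/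
  uniqW_of_cuspV : ∀ σ, cuspV σ → ∀ π π', pair1 σ π → pair1 σ π' → π = π'
  /-- 1) a) for `χ ∈ Irr(U(V^{an}))` (a compact group: every `χ` is cuspidal): its partner at `W_v`
  is unique. -/
  uniqW_of_V0 : ∀ χ π π', pair0 χ π → pair0 χ π' → π = π'
  /-- The Case A / Case B alternative for a cuspidal `π` with partner `σ` (1) a), 1) b), 1) c) and
  the definition of the first occurrence `m'(π) ∈ {0, 1}`): either `σ = ϑ(π)` is cuspidal, or
  `r_1(σ) = ν^e ⊗ χ₀` with `χ₀ = ϑ(π)` the level-0 partner of `π`. -/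
  caseAB : ∀ π σ, cuspW π → pair1 σ π → cuspV σ ∨ ∃ χ₀, jac σ = some χ₀ ∧ pair0 χ₀ π
  /-- 2) b) for a non-cuspidal `σ` with `r_1(σ) = ν^e ⊗ χ₀`, read with [A-2]: either (i) every
  partner `π'` of `σ` at `W_v` pairs with `χ₀` at level 0, or (ii) every partner of `σ` is a quotient
  of a properly induced representation, hence not cuspidal. -/
  dichotomy : ∀ σ χ₀, jac σ = some χ₀ →
    (∀ π', pair1 σ π' → pair0 χ₀ π') ∨ (∀ π', pair1 σ π' → ¬ cuspW π')

variable {IrrW IrrV IrrV0 : Type*}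

/-- **(D_σ) from the skeleton.**  If `π` is cuspidal and `σ ⊗ π` is a quotient of `ω_{V_v, W_v}`,
then `π` is the only partner of `σ` at `W_v`. -/
theorem D_sigma_of_cuspidal (D : Data IrrW IrrV IrrV0) (π : IrrW) (σ : IrrV)
    (hπ : D.cuspW π) (h : D.pair1 σ π) : ∀ π', D.pair1 σ π' → π' = π := by
  intro π' h'
  rcases D.caseAB π σ hπ h with hσ | ⟨χ₀, hj, h0⟩
  · -- Case A: `σ` cuspidal, 1) a) for `σ`
    exact D.uniqW_of_cuspV σ hσ π' π h' h
  · -- Case B: the dichotomy; (ii) is impossible because `π` itself is a cuspidal partner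
    rcases D.dichotomy σ χ₀ hj with hi | hii
    · exact D.uniqW_of_V0 χ₀ π' π (hi π' h') (hi π h)
    · exact absurd hπ (hii π h)

/-- **(D_π) from the skeleton** (route-2's N3.10.4): a cuspidal `π` has a unique partner at `V_v`. -/
theorem D_pi_of_cuspidal (D : Data IrrW IrrV IrrV0) (π : IrrW) (σ : IrrV)
    (hπ : D.cuspW π) (h : D.pair1 σ π) : ∀ σ', D.pair1 σ' π → σ' = σ :=
  fun σ' h' => D.uniqV_of_cuspW π hπ σ' σ h' h

/-- Both uniqueness statements at once: the partner relation restricted to `{σ} × Irr(U(W_v))`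
and to `Irr(U(V_v)) × {π}` is the single pair `(σ, π)`. -/
theorem partners_eq_singleton (D : Data IrrW IrrV IrrV0) (π : IrrW) (σ : IrrV)
    (hπ : D.cuspW π) (h : D.pair1 σ π) :
    (∀ π', D.pair1 σ π' ↔ π' = π) ∧ (∀ σ', D.pair1 σ' π ↔ σ' = σ) := by
  refine ⟨fun π' => ⟨D_sigma_of_cuspidal D π σ hπ h π', ?_⟩,
    fun σ' => ⟨D_pi_of_cuspidal D π σ hπ h σ', ?_⟩⟩
  · rintro rfl; exact h
  · rintro rfl; exact h

/-- In branch (ii) of the dichotomy no partner of `σ` is cuspidal; so a non-cuspidal `σ` with a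
cuspidal partner is always in branch (i) — the step «(ii) is NOT in force» of §14(d), isolated. -/
theorem branch_i_of_cuspidal_partner (D : Data IrrW IrrV IrrV0) (σ : IrrV) (χ₀ : IrrV0)
    (hj : D.jac σ = some χ₀) (π : IrrW) (hπ : D.cuspW π) (h : D.pair1 σ π) :
    ∀ π', D.pair1 σ π' → D.pair0 χ₀ π' := by
  rcases D.dichotomy σ χ₀ hj with hi | hii
  · exact hi
  · exact absurd hπ (hii π h)

end Skeleton

end Summit.Ventures.HodgeRepro2.T5HoweDichotomy
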